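import Summits.CriticalPhenomena.PercolationContinuityZ3.Theorems.Transplant.D10SKc00_4511P1
import HarnessLib

/-!
# Diamond film `D_10` — KERNEL CERTIFICATE for the class `00_4511` of `ShapedLinkageX 4 (DiamondFilm.sqShadow (k := 10))`, THE CLASS (mask + coverage from the 1 parts) (template `fullmcpk`, |W| = 137, 1722 terminal pairs, 5104 plans)

builds on p205010 (kernel theorem, internal audit signed; external expert review pending) — NOT used in this file.  Lane `prim-bschramm`, seat `prim-bschramm-p2` (gen 43; class C1b;
memo `HOME/bschramm/P2-LATTICES.md` §152); helper file (`--supports stmt-CriticalPhenomena-4575 --as helper`).  Generated by `cert/emit_dk.py` from the plans of `cert/gen_dk.py`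
(canonical BFS routings with avoid hints, exact mirror `cert/kern_dk.py` of «DkSKDefs»); re-checked here by the kernel (`DCtx.checkEs`); `caseOK_k10_00_4511` feeds «D10SKFinal».
[cite: DuminilCopinSidoraviciusTassion2016, §2.3 (proof of Fact 2: the three disjoint paths in B_R(z))]
-/

namespace Summit.CriticalPhenomena.PercolationContinuityZ3.Theorems.Transplant

namespace DiamondFilm.DK

/-- The cleared mask of the class `00_4511` of `D_10` is admissible (inside the cleared block, containing the forced core). [folklore] -/
theorem wOK_k10_00_4511 : DCtx.wOK (⟨10, 0, 0, 4, 5, 1, 1, 6460589752318435243073020111134167967933328094001669193227167347456579178725460569381805356293319975339474342556704522240⟩ : DCtx) = true := by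
  decide +kernel

/-- **THE CLASS `00_4511` OF `D_10` IS COVERED**: every needed bit of every certified terminal pair has a swap-pair plan. [cite: DuminilCopinSidoraviciusTassion2016, §2.3 (proof of Fact 2)] -/
theorem caseOK_k10_00_4511 : CaseOK (⟨10, 0, 0, 4, 5, 1, 1, 6460589752318435243073020111134167967933328094001669193227167347456579178725460569381805356293319975339474342556704522240⟩ : DCtx) :=
  caseOK_of_chunks _ [[14, 16, 18, 25, 27, 29], [49, 73, 97, 99, 101, 110], [112, 114, 158, 159, 160, 161], [162, 169, 181, 193, 205, 217], [229, 241, 254, 255, 256, 257], [258, 303, 305, 313, 325, 337], [349, 361, 373, 385, 399, 401]]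
    (List.forall_mem_cons.2 ⟨checkEs_sound _ _ _ chunk_k10_00_4511_0, List.forall_mem_cons.2 ⟨checkEs_sound _ _ _ chunk_k10_00_4511_1, List.forall_mem_cons.2 ⟨checkEs_sound _ _ _ chunk_k10_00_4511_2, List.forall_mem_cons.2 ⟨checkEs_sound _ _ _ chunk_k10_00_4511_3, List.forall_mem_cons.2 ⟨checkEs_sound _ _ _ chunk_k10_00_4511_4, List.forall_mem_cons.2 ⟨checkEs_sound _ _ _ chunk_k10_00_4511_5, List.forall_mem_cons.2 ⟨checkEs_sound _ _ _ chunk_k10_00_4511_6, List.forall_mem_nil _⟩⟩⟩⟩⟩⟩⟩)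
    (by decide +kernel)

end DiamondFilm.DK

end Summit.CriticalPhenomena.PercolationContinuityZ3.Theorems.Transplant
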